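import Literature.Topology.Immersions.WrinkledEmbeddingsRoundCollarProofs
import Literature.Topology.Immersions.WrinkledEmbeddingsRoundCollarRoundPart
import Literature.Topology.Immersions.WrinkledEmbeddingsRoundCollarTransversalRotation
import HarnessLib

/-!
# The three named facts of `WrinkledEmbeddingsRoundCollar`: what is left after the companions
# (assembly of `…Proofs`, `…RoundPart`, `…TransversalRotation`)

Topic `Literature/Topology/Immersions`; fourth companion of `WrinkledEmbeddingsRoundCollar.lean`,
whose three NAMED FACTS

* (F1)
  `Literature.Topology.Immersions.EliashbergMishachev2009_doubleFolds_of_hasTransversalRotation`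
  (Eliashberg–Mishachev 2009, Thm. 3.2 in double-fold / relative / `C⁰`-small form, hypersurfaces of
  `ℝ⁵` with round lower part, vertical line foliation),
* (F2) `Literature.Topology.Immersions.exists_isSmoothEmbedding_roundPart` (Kosinski VI: round lower
  part by an embedded connected sum with the unit sphere),
* (F3) `Literature.Topology.Immersions.hasTransversalRotation_of_homotopyEquiv_sphere_four`
  (Guillemin–Pollack Ch. 4 §9 / Hopf: the formal datum on an embedded homotopy `4`-sphere with round
  lower part)

enter the crux skeleton of route `SmoothPoincare4/SymplecticOrigami`, line `shadow-pleats`, as ONE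
conjunctive stub `F1 ∧ F2 ∧ F3`.  The three companion files have meanwhile

* PROVED (F2): `exists_isSmoothEmbedding_roundPart_holds` (`…RoundPart.lean`);
* REDUCED (F3) to Hopf's curvatura integra theorem in dimension `4` as the only hypothesis:
  `hasTransversalRotation_of_homotopyEquiv_sphere_four_of_gauss (hGauss4)`
  (`…TransversalRotation.lean`, Part II: Hopf's degree theorem for homotopy `4`-spheres is PROVED
  there, `homotopic_of_hasDegree_of_homotopyEquiv`; the remaining hypothesis is
  `2 deg (Gauss map) = χ`, Guillemin–Pollack Ch. 4 §9 p. 198);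
* REDUCED (F1) to the ENGINE of the printed proof (Eliashberg–Mishachev Thm. 2.10 relative + §2.3 B
  regularization + round packaging, in smooth Gauss-map form on a closed `4`-manifold):
  `EliashbergMishachev2009_doubleFolds_of_engine (engine)` (`…Proofs.lean`, §10).

This file only ASSEMBLES: `wrinkledEmbeddingFacts_of_doubleFolds_of_hasTransversalRotation` — the
conjunction from (F1) and (F3) alone (F2 is a theorem); and
`wrinkledEmbeddingFacts_of_engine_of_gauss` — the conjunction from exactly the two remaining
classical debts `engine`, `hGauss4`, copied VERBATIM from the two reductions (so a user who wants
to carry the finer debts as hypotheses has their literal text — with the local notations `𝔼 n`,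
`𝕊⁴` of those files expanded — and a kernel-checked composition).  Nothing new is claimed or
defined; no fact is discharged here beyond quoting `exists_isSmoothEmbedding_roundPart_holds`.

## References

* Y. Eliashberg, N. Mishachev, *Wrinkled embeddings*, Contemp. Math. **498** (2009), 207–232,
  Thm. 2.10, §2.3 B, Thm. 3.2 with its Remarks. [EliashbergMishachev2009]
* V. Guillemin, A. Pollack, *Differential Topology* (1974), Ch. 4 §9 p. 198 (curvatura integra).
  [GuilleminPollack1974]
* A. A. Kosinski, *Differential Manifolds* (1993), Ch. VI, Prop. 1.3, Thm. 2.2 (c). [Kosinski1993]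
-/

open scoped Manifold ContDiff Topology InnerProductSpace ContinuousMap
open Set Function

namespace Literature.Topology.Immersions

open Literature.Topology.FourManifolds Literature.AlgebraicTopology.SingularHomology

/-- **The conjunction of the three facts, from (F1) and (F3) alone**: the middle conjunct (F2),
round lower part by an embedded connected sum with the unit sphere, is the tree theorem
`exists_isSmoothEmbedding_roundPart_holds`. [folklore] -/
theorem wrinkledEmbeddingFacts_of_doubleFolds_of_hasTransversalRotation
    (hEM : EliashbergMishachev2009_doubleFolds_of_hasTransversalRotation)
    (hTR : hasTransversalRotation_of_homotopyEquiv_sphere_four) :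
    EliashbergMishachev2009_doubleFolds_of_hasTransversalRotation ∧
      exists_isSmoothEmbedding_roundPart ∧
      hasTransversalRotation_of_homotopyEquiv_sphere_four :=
  ⟨hEM, exists_isSmoothEmbedding_roundPart_holds, hTR⟩

/-- **The conjunction of the three facts from the two remaining classical debts** — the
wrinkled-embeddings ENGINE (`engine`: Eliashberg–Mishachev Thm. 2.10 relative + §2.3 B, Gauss-map
form for hypersurfaces of `ℝ⁵` and the vertical line field, verbatim the hypothesis of
`EliashbergMishachev2009_doubleFolds_of_engine`) and HOPF'S CURVATURA INTEGRA THEOREM in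
dimension `4` (`hGauss4`, verbatim the hypothesis of
`hasTransversalRotation_of_homotopyEquiv_sphere_four_of_gauss`); (F2) is the theorem
`exists_isSmoothEmbedding_roundPart_holds`, Hopf's degree theorem is the theorem
`homotopic_of_hasDegree_of_homotopyEquiv`.
[cite: EliashbergMishachev2009, Thm. 2.10, §2.3 B, Thm. 3.2 Remarks 1–2] -/
theorem wrinkledEmbeddingFacts_of_engine_of_gauss
    (engine : ∀ (M : Type) [TopologicalSpace M] [T2Space M] [SecondCountableTopology M]
      [CompactSpace M] [ChartedSpace (EuclideanSpace ℝ (Fin 4)) M] [IsManifold (𝓡 4) ∞ M]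
      (ι : M → EuclideanSpace ℝ (Fin 5)),
      ContMDiff (𝓡 4) (𝓡 5) ∞ ι → Injective ι → (∀ m, Injective (mfderiv (𝓡 4) (𝓡 5) ι m)) →
      ∀ (Φ : M × ℝ → EuclideanSpace ℝ (Fin 5)),
      ContMDiff ((𝓡 4).prod 𝓘(ℝ, ℝ)) 𝓘(ℝ, EuclideanSpace ℝ (Fin 5)) ∞ Φ →
      (∀ p, ‖Φ p‖ = 1) →
      (∀ (m : M) (v : TangentSpace (𝓡 4) m),
        ⟪Φ (m, 0), (mfderiv (𝓡 4) (𝓡 5) ι m v : EuclideanSpace ℝ (Fin 5))⟫_ℝ = 0) →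
      ∀ (A O : Set M), IsClosed A → IsOpen O → A ⊆ O →
      (∀ m ∈ O, ∀ t : ℝ, Φ (m, t) = Φ (m, 0)) →
      (∀ m ∈ closure Aᶜ, Φ (m, 1) 4 ≠ 0) →
      ∀ ε : ℝ, 0 < ε →
      ∃ (ι' : M → EuclideanSpace ℝ (Fin 5)) (k : ℕ) (e : Fin k → EuclideanSpace ℝ (Fin 4) → M),
        Manifold.IsSmoothEmbedding (𝓡 4) (𝓡 5) ∞ ι' ∧
        (∀ m, dist (ι' m) (ι m) < ε) ∧
        (∃ O' : Set M, IsOpen O' ∧ A ⊆ O' ∧ ∀ m ∈ O', ι' m = ι m) ∧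
        (∀ j, Manifold.IsSmoothEmbedding (𝓡 4) (𝓡 4) ∞ (e j) ∧ ∀ u, e j u ∉ A) ∧
        Pairwise (Function.onFun Disjoint fun j => e j '' doubleFoldSpheres) ∧
        (∀ m, m ∉ A → m ∉ (⋃ j, e j '' doubleFoldSpheres) →
          Injective (mfderiv (𝓡 4) (𝓡 4) (shadowProj ∘ ι') m)) ∧
        (∀ j, ∀ u ∈ doubleFoldSpheres, IsWhitneyFoldAt (shadowProj ∘ ι' ∘ e j) u))
    (hGauss4 : ∀ (X : Type) [TopologicalSpace X] [T2Space X] [CompactSpace X] [ConnectedSpace X]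
      [ChartedSpace (EuclideanSpace ℝ (Fin 4)) X] [IsManifold (𝓡 4) ∞ X]
      (F : X → EuclideanSpace ℝ (Fin 5))
      (hF : Manifold.IsSmoothEmbedding (𝓡 4) (𝓡 5) ∞ F) (o : SmoothOrientation (𝓡 4) X)
      (oS : SmoothOrientation (𝓡 4) (Metric.sphere (0 : EuclideanSpace ℝ (Fin 5)) 1))
      (g : HomologicalOrientation ℤ (EuclideanSpace ℝ (Fin 4)) 4)
      (μ : HomologicalOrientation ℤ X 4)
      (μS : HomologicalOrientation ℤ (Metric.sphere (0 : EuclideanSpace ℝ (Fin 5)) 1) 4),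
      SmoothOrientation.IsCompatible g o μ → SmoothOrientation.IsCompatible g oS μS →
      (∀ y : Metric.sphere (0 : EuclideanSpace ℝ (Fin 5)) 1,
        orientedNormal oS
            (Subtype.val :
              Metric.sphere (0 : EuclideanSpace ℝ (Fin 5)) 1 → EuclideanSpace ℝ (Fin 5))
            y = (y : EuclideanSpace ℝ (Fin 5))) →
      ∀ d : ℤ, HasDegree μ μS (gaussMapEmb o hF) d → 2 * d = relEuler ℤ ℤ X ∅) :
    EliashbergMishachev2009_doubleFolds_of_hasTransversalRotation ∧
      exists_isSmoothEmbedding_roundPart ∧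
      hasTransversalRotation_of_homotopyEquiv_sphere_four :=
  wrinkledEmbeddingFacts_of_doubleFolds_of_hasTransversalRotation
    (EliashbergMishachev2009_doubleFolds_of_engine engine)
    (hasTransversalRotation_of_homotopyEquiv_sphere_four_of_gauss hGauss4)

end Literature.Topology.Immersions
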